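import Summits.QuantumFields.BalabanUV.T4Continuum.Support.NE7LocalLandauGradientLetter
import Summits.QuantumFields.BalabanUV.T4Continuum.Support.NE7WeightedGradientBootstrap
import Summits.QuantumFields.BalabanUV.T4Continuum.Support.NE7FlatInteriorGradientModulusVec
import HarnessLib

/-!
# NE7CubeLandauReg910 — [Balaban1985Variational] Thm 1 (9)₂, (10) AND (9)₃ FOR EVERY `β < 1` ON A CUBE, FROM A LOCAL LANDAU CHART WITH SUP CURRENCY `a₀` AND THE COVARIANT
# CURRENT `j` — NO OTHER LETTER: the BOX ROUTE assembled (G1 local letters → G2 weighted bootstrap ⇒ (9)₂ on the half cube; G1b local Laplacian letter ⇒ (10); F3 interior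
# `C^{1,β<1}` letter ⇒ (9)₃), every `d ≥ 3`, every `U(n)`, constants depending on `d` only (file G3a of gen 112; the docking to the row's minimisers through gen 93's
# one-scale Uhlenbeck chart `NE7CubeLandauChart.cube_landau_chart` and gen 111's current bound ✓ p814818 is the companion G3b)

Cell `pub-balaban`, rung (B)+1 sub-cell t4, lineage `b2b-balaban-t4-ne7-p1` (CRUX PROVER NE7 #1 = OWNER of BINDER row NE7), generation 112.  Memo
`t4/b2b-balaban-t4-ne7-p1-g112/ROAD-G112.md` §5.
THE SETTING (= the OUTPUT SHAPE of gen 93's `cube_landau_chart`, taken as hypotheses; def-free).  A configuration `W : ℤᵈ → (Fin d → U(n))` with `SmallField W ε` and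
`‖covDiv 1 W ν y‖ ≤ j` everywhere (in use `W = U^{u}`: both are gauge invariant), a bond field `A` and a cube `{|y − z|_∞ ≤ S}` on which `W(y)_κ = expUnit (A(y)_κ)`, `‖A(y)_κ‖ ≤ a₀`
(`a₀ ≤ 1∕4`) and the `sinh`-Landau condition `Σ_κ [sinh A(y)_κ − sinh A(y − e_κ)_κ] = 0` hold.  Abbreviations (spelled out in the statements): `b₀ = e^{a₀} − 1`,
`j_ε = j + d(ε·b₀(2 + b₀) + 2ε²(2 + ε))`, `θ = 4d(e^{4a₀} − 1) + 2d(e^{a₀} − 1)` (`≤ 36d·a₀`), `G₁ = 36d·a₀∕R₀ + 4R₀·j_ε`, `Λ = j_ε + θ·G₁`.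
THE THEOREM (**`cube_landau_reg910`**, `d ≥ 3`): `∃ C = C(d) ≥ 0` such that in the setting, for every `R₀ ≥ 2` with `R₀ + 4 ≤ S` and `144·d·a₀·R₀ ≤ 1`:
 (9)₂ `‖A(x+e_τ)_κ − A(x)_κ‖ ≤ G₁` for `2|x − z|_∞ ≤ R₀`;  (10) `‖ΔA_ν(y)‖ ≤ Λ` for `|y − z|_∞ ≤ R₁` whenever `2(R₁ + 1) ≤ R₀`;
 (9)₃ for every `m ≥ 1` with `2(7m + 1) ≤ R₀`, every `β ∈ [0,1)`, all `z₁, z₂ ∈ cube z (m − 1)` (`h = |z₁ − z₂|_∞`):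
 `‖(A(z₁+e_μ)_κ − A(z₁)_κ) − (A(z₂+e_μ)_κ − A(z₂)_κ)‖ ≤ C(1 + (1−β)⁻¹)(Λ + a₀∕m²)(3m)^{1−β}h^β`.
READING (print's scaling, ROAD-G112 §5).  At level `k`, `M = L^k`, plaquettes `ε = r∕M²`, current `j = c_j r∕M³` (✓ p814818), chart radius `S ≍ 16M` with `a₀ ≍ c₀ r∕M` (gen 93:
`a₀ ≤ 128d³(2S+3)ε′`), `R₀ = 16M`, `m = M`: `j_ε = O(r∕M³)`, `G₁ = O(r∕M²)` = (9)₂, `Λ = O(r∕M³)` = (10), (9)₃ `≤ C_β·r·h^β∕M^{2+β}` over the physical unit box — the regime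
`144·d·a₀·R₀ ≤ 1` reads `2304·d·c₀·r ≤ 1`: k-UNIFORM.  NO logarithm, NO boundary regularity, NO torus zero mode, NO displayed letter beyond the chart.
HONEST FRAMING (page 1): composition of landed kernel theorems (G1, G1b, G2, F3, (156)); the chart is a HYPOTHESIS here (gen 93 proves it for every small-field configuration on
every cube in the regime `(side)²·ε ≪ 1`); nothing of Bałaban's asserted ([Balaban1985Variational]∕[Balaban1985RegularSpaces] prove (9)∕(10) by the induction of Sect. A and
the regular-space machinery, at `β₀ = 1` as printed — the junction logarithm, ROAD-G110 §4, keeps `β = 1` out of reach of THIS route); NOT NE3∕NE7 as spine nodes; spine 0∕9; finite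
T⁴ rung (B)+1 — NOT infinite volume, NOT mass gap, NOT BetaPertH, NOT Clay (continuum YM on T⁴ ⇐ BetaPertH ∧ nine spine estimates).  0 def, 0 sorry.
-/

set_option autoImplicit false

open NormedSpace
open scoped BigOperators Matrix Matrix.Norms.L2Operator
open Finset

namespace Summit.QuantumFields.BalabanUV.T4Continuum.NE7CubeLandauReg910

open Literature.MathematicalPhysics.QuantumFieldTheory.Balaban1983to89
open B7Prop1Explicit B7Prop2Explicit
open B8Ineq132 (covDiv)
open T4AveragingDeficitWall (SmallField)
open Beta.PoissonInterior (cube mem_cube mem_cube_iff_supNorm supNorm supNorm_add_le)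
open NE7LocalLandauLetters (near_mono near_trans)
open NE7LocalLandauGradientLetter (local_gradient_letter local_laplacian_letter)
open NE7WeightedGradientBootstrap (gradient_halfCube_of_bootstrap supNorm_sub_le_of)
open NE7FlatInteriorGradientModulusVec (interior_gradient_holder_vec)

noncomputable section

variable {d : ℕ} {n : Type*} [Fintype n] [DecidableEq n] [Nonempty n]

omit [Fintype n] [DecidableEq n] [Nonempty n] in
/-- The two spellings of a sup-neighbourhood: `(∀ i, |y i − x i| ≤ R) ↔ supNorm (y − x) ≤ R`. [folklore] -/
theorem near_iff_supNorm {y x : Site d} {R : ℕ} : (∀ i, |y i - x i| ≤ (R : ℤ)) ↔ supNorm (y - x) ≤ R := by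
  rw [← mem_cube_iff_supNorm, mem_cube]

omit [Fintype n] [DecidableEq n] [Nonempty n] in
/-- `θ = 4d(e^{4a₀} − 1) + 2d(e^{a₀} − 1) ≤ 36d·a₀` for `0 ≤ a₀ ≤ 1∕4`. [folklore] -/
theorem theta_le {a₀ : ℝ} (h0 : 0 ≤ a₀) (h4 : a₀ ≤ 1 / 4) :
    4 * (d : ℝ) * (Real.exp (4 * a₀) - 1) + 2 * d * (Real.exp a₀ - 1) ≤ 36 * d * a₀ := by
  have hexp : ∀ t : ℝ, 0 ≤ t → t ≤ 1 → Real.exp t - 1 ≤ 2 * t := fun t ht0 ht1 => by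
    have h' := Real.abs_exp_sub_one_le (x := t) (by rw [abs_of_nonneg ht0]; exact ht1)
    rw [abs_of_nonneg ht0] at h'
    exact (le_abs_self _).trans h'
  have h1 : Real.exp (4 * a₀) - 1 ≤ 2 * (4 * a₀) := hexp _ (by positivity) (by linarith)
  have h2 : Real.exp a₀ - 1 ≤ 2 * a₀ := hexp _ h0 (by linarith)
  have hd0 : (0 : ℝ) ≤ d := Nat.cast_nonneg d
  nlinarith [mul_le_mul_of_nonneg_left h1 (by positivity : (0:ℝ) ≤ 4 * d), mul_le_mul_of_nonneg_left h2 (by positivity : (0:ℝ) ≤ 2 * d)]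

/-- **(9)₂, (10), (9)₃^{β<1} ON A CUBE FROM A LOCAL LANDAU CHART** — see the module docstring. [folklore] -/
theorem cube_landau_reg910 (hd : 3 ≤ d) : ∃ C : ℝ, 0 ≤ C ∧
    ∀ (W : Site d → Fin d → (Matrix n n ℂ)ˣ) (A : Site d → Fin d → Matrix n n ℂ) (z : Site d) (S : ℤ) (ε a₀ j : ℝ),
    0 ≤ ε → 0 ≤ a₀ → a₀ ≤ 1 / 4 → 0 ≤ j → SmallField W ε → (∀ (ν : Fin d) (y : Site d), ‖covDiv 1 W ν y‖ ≤ j) →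
    (∀ y : Site d, (∀ i, |y i - z i| ≤ S) → ∀ κ : Fin d, W y κ = expUnit (A y κ)) →
    (∀ y : Site d, (∀ i, |y i - z i| ≤ S) → ∀ κ : Fin d, ‖A y κ‖ ≤ a₀) →
    (∀ y : Site d, (∀ i, |y i - z i| ≤ S) →
      ∑ κ : Fin d, (((2 : ℂ)⁻¹ • (exp (A y κ) - exp (-A y κ))) - ((2 : ℂ)⁻¹ • (exp (A (y - e κ) κ) - exp (-A (y - e κ) κ)))) = 0) →
    ∀ (R₀ : ℕ), 2 ≤ R₀ → (R₀ : ℤ) + 4 ≤ S → 144 * (d : ℝ) * a₀ * R₀ ≤ 1 →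
    -- (9)₂ on the half cube
    (∀ x : Site d, 2 * supNorm (x - z) ≤ R₀ → ∀ κ τ : Fin d,
      ‖A (x + e τ) κ - A x κ‖ ≤ 36 * d * a₀ / R₀
        + 4 * R₀ * (j + d * (ε * (Real.exp a₀ - 1) * (2 + (Real.exp a₀ - 1)) + 2 * ε * ε * (2 + ε)))) ∧
    -- (10) on an inner cube
    (∀ R₁ : ℕ, 2 * (R₁ + 1) ≤ R₀ → ∀ y : Site d, supNorm (y - z) ≤ R₁ → ∀ ν : Fin d,
      ‖∑ i, ((A (y + e i) ν - A y ν) - (A y ν - A (y - e i) ν))‖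
        ≤ (j + d * (ε * (Real.exp a₀ - 1) * (2 + (Real.exp a₀ - 1)) + 2 * ε * ε * (2 + ε)))
          + (4 * d * (Real.exp (4 * a₀) - 1) + 2 * d * (Real.exp a₀ - 1))
            * (36 * d * a₀ / R₀ + 4 * R₀ * (j + d * (ε * (Real.exp a₀ - 1) * (2 + (Real.exp a₀ - 1)) + 2 * ε * ε * (2 + ε))))) ∧
    -- (9)₃ for every β < 1 on cubes `cube z (m − 1)` with `2(7m+1) ≤ R₀`
    (∀ m : ℕ, 1 ≤ m → 2 * (7 * m + 1) ≤ R₀ → ∀ β : ℝ, 0 ≤ β → β < 1 →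
      ∀ z₁ z₂ : Site d, z₁ ∈ cube z (m - 1) → z₂ ∈ cube z (m - 1) → ∀ μ κ : Fin d,
      ‖(A (z₁ + e μ) κ - A z₁ κ) - (A (z₂ + e μ) κ - A z₂ κ)‖
        ≤ C * (1 + (1 - β)⁻¹)
          * (((j + d * (ε * (Real.exp a₀ - 1) * (2 + (Real.exp a₀ - 1)) + 2 * ε * ε * (2 + ε)))
              + (4 * d * (Real.exp (4 * a₀) - 1) + 2 * d * (Real.exp a₀ - 1))
                * (36 * d * a₀ / R₀ + 4 * R₀ * (j + d * (ε * (Real.exp a₀ - 1) * (2 + (Real.exp a₀ - 1)) + 2 * ε * ε * (2 + ε)))))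
              + a₀ / (m : ℝ) ^ 2)
          * (3 * m : ℝ) ^ (1 - β) * (supNorm (z₁ - z₂) : ℝ) ^ β) := by
  obtain ⟨C, hC, hhol⟩ := interior_gradient_holder_vec (d := d) (E := Matrix n n ℂ) hd
  have hd1 : 1 ≤ d := by omega
  refine ⟨C, hC, fun W A z S ε a₀ j hε0 ha₀0 ha₀4 hj0 hWε hcov hWexp hA hEL R₀ hR₀ hS hreg => ?_⟩
  -- abbreviations
  set jε : ℝ := j + d * (ε * (Real.exp a₀ - 1) * (2 + (Real.exp a₀ - 1)) + 2 * ε * ε * (2 + ε)) with hjεdef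
  set θ : ℝ := 4 * d * (Real.exp (4 * a₀) - 1) + 2 * d * (Real.exp a₀ - 1) with hθdef
  have hb0 : 0 ≤ Real.exp a₀ - 1 := by linarith [Real.add_one_le_exp a₀]
  have hb4 : 0 ≤ Real.exp (4 * a₀) - 1 := by linarith [Real.add_one_le_exp (4 * a₀)]
  have hjε0 : 0 ≤ jε := by
    have : 0 ≤ ε * (Real.exp a₀ - 1) * (2 + (Real.exp a₀ - 1)) + 2 * ε * ε * (2 + ε) := by positivity
    positivity
  have hθ0 : 0 ≤ θ := by positivity
  have hθle : θ ≤ 36 * d * a₀ := theta_le ha₀0 ha₀4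
  have hR₀0 : (0 : ℝ) ≤ R₀ := Nat.cast_nonneg R₀
  have hθR : 4 * θ * R₀ ≤ 1 := by nlinarith
  -- the conditional local letter (G1b) in G2's language
  have hloc : ∀ x₀ : Site d, supNorm (x₀ - z) ≤ R₀ → ∀ R : ℕ, 1 ≤ R → R + 2 + supNorm (x₀ - z) ≤ R₀ →
      ∀ G : ℝ, (∀ y : Site d, supNorm (y - x₀) ≤ R + 1 → ∀ κ τ : Fin d, ‖A (y + e τ) κ - A y κ‖ ≤ G) →
      ∀ κ τ : Fin d, ‖A (x₀ + e τ) κ - A x₀ κ‖ ≤ 2 * ((d : ℝ) * a₀ / R + R * (jε + θ * G)) := by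
    intro x₀ hx₀ R hR hfitR G hG κ τ
    have hfit : ∀ y : Site d, (∀ i, |y i - x₀ i| ≤ (R : ℤ) + 3) → ∀ i, |y i - z i| ≤ S := by
      intro y hy
      have h1 : supNorm (y - x₀) ≤ R + 3 := (near_iff_supNorm (R := R + 3)).1 (by push_cast; exact hy)
      have h2 : supNorm (y - z) ≤ R₀ + 1 := by have := supNorm_sub_le_of y x₀ z; omega
      have h3 : ∀ i, |y i - z i| ≤ ((R₀ + 1 : ℕ) : ℤ) := (near_iff_supNorm (R := R₀ + 1)).2 h2
      exact near_mono h3 (by push_cast; omega)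
    have hG' : ∀ y : Site d, (∀ i, |y i - x₀ i| ≤ (R : ℤ) + 1) → ∀ κ τ : Fin d, ‖A (y + e τ) κ - A y κ‖ ≤ G := by
      intro y hy
      exact hG y ((near_iff_supNorm (R := R + 1)).1 (by push_cast; exact hy))
    have h := local_gradient_letter W A z S hε0 ha₀0 hWε hcov hWexp hA hEL x₀ hR hfit hG' κ τ
    refine h.trans (le_of_eq ?_)
    rw [hjεdef, hθdef]; ring
  have hρ : ∀ x : Site d, supNorm (x - z) ≤ R₀ + 1 → ∀ κ : Fin d, ‖A x κ‖ ≤ a₀ := by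
    intro x hx κ
    refine hA x (near_mono ((near_iff_supNorm (R := R₀ + 1)).2 hx) (by push_cast; omega)) κ
  -- (9)₂
  have h92 : ∀ x : Site d, 2 * supNorm (x - z) ≤ R₀ → ∀ κ τ : Fin d, ‖A (x + e τ) κ - A x κ‖ ≤ 36 * d * a₀ / R₀ + 4 * R₀ * jε :=
    fun x hx κ τ => gradient_halfCube_of_bootstrap hd1 A z hR₀ ha₀0 hjε0 hθ0 hθR hρ hloc x hx κ τ
  -- (10)
  have h10 : ∀ R₁ : ℕ, 2 * (R₁ + 1) ≤ R₀ → ∀ y : Site d, supNorm (y - z) ≤ R₁ → ∀ ν : Fin d,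
      ‖∑ i, ((A (y + e i) ν - A y ν) - (A y ν - A (y - e i) ν))‖ ≤ jε + θ * (36 * d * a₀ / R₀ + 4 * R₀ * jε) := by
    intro R₁ hR₁ y hy ν
    have hfit : ∀ y' : Site d, (∀ i, |y' i - z i| ≤ (R₁ : ℤ) + 3) → ∀ i, |y' i - z i| ≤ S :=
      fun y' hy' => near_mono hy' (by omega)
    have hG : ∀ y' : Site d, (∀ i, |y' i - z i| ≤ (R₁ : ℤ) + 1) → ∀ κ τ : Fin d,
        ‖A (y' + e τ) κ - A y' κ‖ ≤ 36 * d * a₀ / R₀ + 4 * R₀ * jε := by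
      intro y' hy'
      have h1 : supNorm (y' - z) ≤ R₁ + 1 := (near_iff_supNorm (R := R₁ + 1)).1 (by push_cast; exact hy')
      exact h92 y' (by omega)
    have h := local_laplacian_letter W A z S hε0 ha₀0 hWε hcov hWexp hA hEL z R₁ hfit hG y ((near_iff_supNorm (R := R₁)).2 hy) ν
    refine h.trans (le_of_eq ?_)
    rw [hjεdef, hθdef]; ring
  refine ⟨h92, h10, fun m hm hmR β hβ0 hβ1 z₁ z₂ hz₁ hz₂ μ κ => ?_⟩
  -- (9)₃: F3 on `cube z (7m)` with the Laplacian bound of (10) at `R₁ = 7m` and the sup bound `a₀`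
  have hΛ : ∀ y ∈ cube z (7 * m), ‖∑ i, (((fun w => A w κ) (y + e i) - (fun w => A w κ) y) - ((fun w => A w κ) y - (fun w => A w κ) (y - e i)))‖
      ≤ jε + θ * (36 * d * a₀ / R₀ + 4 * R₀ * jε) :=
    fun y hy => h10 (7 * m) (by omega) y ((mem_cube_iff_supNorm).1 hy) κ
  have hS' : ∀ y ∈ cube z (7 * m), ‖(fun w => A w κ) y‖ ≤ a₀ := by
    intro y hy
    have h1 : supNorm (y - z) ≤ 7 * m := (mem_cube_iff_supNorm).1 hy
    exact hA y (near_mono ((near_iff_supNorm (R := 7 * m)).2 h1) (by push_cast; omega)) κ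
  exact hhol m hm (fun w => A w κ) z _ a₀ hΛ hS' β hβ0 hβ1 z₁ z₂ hz₁ hz₂ μ

end

end Summit.QuantumFields.BalabanUV.T4Continuum.NE7CubeLandauReg910
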